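/-
Copyright (c) 2026 the pub-hodgecm-mathlib formalisation cell (harness21).  Prover seat hodgecm-mathlib-A-p03 (g30), P6 «MOD programme»,
organ (ν8) = (G-q) «ROOF-LEG REDUCTION» of the R6 census (A-p03 (g30) `CENSUS-R6-RoofCoverReadingGlue` §4, `CENSUS-DLINE-stubFROB` §4 (a)); 2026-09-02.
-/
import Literature.AlgebraicGeometry.AbelianSchemes.AbelianSchemeHomReductionTurnkey
import Literature.AlgebraicGeometry.AbelianSchemes.PolarizationLawAtFieldPoint
import Literature.AlgebraicGeometry.AbelianSchemes.SerreTensorRecognitionOfPoints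
import Literature.AlgebraicGeometry.Limits.SeparatedSchematicExt
import Literature.AlgebraicGeometry.AbelianSchemes.SymplecticLiftOfIsogenyTower       -- ★ `map_fibreHom_restrictPt`
import Literature.AlgebraicGeometry.AbelianSchemes.AbelianSchemeFibreKernelTransport   -- ★ `AbelianVariety.iso_hom_hom_hom_hom_comp_inv`
import HarnessLib

/-!
# REDUCTION OF A HOMOMORPHISM BETWEEN FIBRE TUPLES AT TWO `Ω`-POINTS — THE SPECIAL-FIBRE OUTPUT
# (the leg `ū : 𝒜_{x̄} → 𝒞_{x̄″}` of a downstairs roof from the leg `u : 𝒜_x → 𝒞_{x″}` of an upstairs roof; [SerreTate1968] §1, [BoschLutkebohmertRaynaud1990] §1.2 Prop. 8)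

Topic `AlgebraicGeometry/AbelianSchemes`, namespace `Literature.AlgebraicGeometry.AbelianSchemes.AbelianSchemeOver`.  THEOREMS ONLY (no definition, no named
fact, no instance, no notation).  Cell `hodgecm-mathlib` (D-0151), F0∕P6 «MOD», organ **(ν8)**: ★ (ν7) `exists_stage_hom_reduction_turnkey` PRODUCES, from a
homomorphism `u` between the generic fibre tuples of two abelian schemes `𝒜, 𝒞 → 𝓨` at two `Ω`-points `x, x″` of a proper model `𝓨`, a homomorphism `U` over a finite
Dedekind stage whose `Ω`-fibre is `u`; THIS file reads off its SPECIAL fibre: a HOMOMORPHISM `ū` between the special fibre tuples at the reductions `x̄ = red x`,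
`x̄″ = red x″` (in the iterated-base-change currency `(𝒜 ×_𝓨 𝓨_s) ×_{𝓨_s} x̄` of the P6a letters `sch₀Of`∕`act₀Of`∕`pol₀Of`∕`lvlPt₀Of`), TOGETHER WITH THE FOUR TRANSFERS a roof
leg needs: (i) `u` finite surjective ⇒ `ū` flat surjective; (ii) equivariance for endomorphism pairs `(f, g)` of `(𝒜, 𝒞)` (e.g. a ring action) transfers; (iii) identities
of section values transfer (level structures); (iv) a polarisation law `u ≫ λ_𝒞 ≫ u^∨ = λ_𝒜 ≫ [n]` in dual-homomorphism form transfers (★ (G-λ) `PolarizationLawAtFieldPoint`: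
decided at one field point of the connected stage).  (ii)–(iv) are ONE principle: two stage homomorphisms with equal `Ω`-fibre are equal (★ `pullback_map_injective_of_flat`
along the schematically dominant generic point of the refined stage), then specialise and transport along the five-piece along-stage isomorphisms (★ (ν6) §1:
`fibreHom_comp_alongStageIso_hom`, `map_alongStageIso_restrictPt`; ★ (G-λ) §4 `alongStageIso_hom_comp_lam_comp_dualIsogenyOver`).
Consumers: the D-line `stub_FROB` rows (R-2) `quot₀_roof : Roof₀ …` ((r1₀)(r3₀)(r4₀)(r5₀) from the upstairs (r3)(r4)(r5) of `RoofΩ`) and `frob₀_cover` on the (ν)-route.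

HONEST LABEL: HC_CM is proved only modulo the cell's 2 remaining named inputs (hLiu418 24832, h413 24833) until rung 0 closes; generic capital on
`--supports stmt-HodgeConjecture-24832`, pays no letter.

## References
* [SerreTate1968] J.-P. Serre, J. Tate, *Good reduction of abelian varieties*, Ann. of Math. 88 (1968), §1 (Lemma 2, Theorem 1).
* [BoschLutkebohmertRaynaud1990] S. Bosch, W. Lütkebohmert, M. Raynaud, *Néron Models* (1990), §1.2 Prop. 8, §7.3 Prop. 6 (p. 180).
* [MumfordFogartyKirwan1994] D. Mumford, J. Fogarty, F. Kirwan, *GIT*, 3rd ed., Ch. 6 §1 Cor. 6.2 (p. 116), Ch. 7 §2 Def. 7.1–7.2 (p. 129).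
* [MumfordAV1970] D. Mumford, *Abelian Varieties* (1970), §15 Thm. 1 (p. 143).
* [EGAIV3] A. Grothendieck, J. Dieudonné, EGA IV₃ (1966), 11.10.5.
-/

set_option autoImplicit false

noncomputable section

set_option backward.isDefEq.respectTransparency false

open CategoryTheory CategoryTheory.Limits AlgebraicGeometry
open scoped MonObj CategoryTheory.Obj NumberField
open Literature.AlgebraicGeometry.Motives
open IsDedekindDomain IsDedekindDomain.HeightOneSpectrum ValuativeRel
open Literature.NumberTheory.EllipticCurves (genericFibre specGenericPoint)
open Literature.NumberTheory.GaloisRepresentations (closureValuationSubring)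
open Literature.NumberTheory.DiophantineGeometry

namespace Literature.AlgebraicGeometry.AbelianSchemes

namespace AbelianSchemeOver

universe u

section Bookkeeping

/-! ### §0 Category bookkeeping: conjugating commuting squares through isomorphisms -/

variable {𝒱 : Type*} [Category 𝒱]

/-- If `U′ = E_A⁻¹ ≫ u ≫ E_C`, `F′ = E_A⁻¹ ≫ f ≫ E_A`, `G′ = E_C⁻¹ ≫ g ≫ E_C` and `f ≫ u = u ≫ g`, then `F′ ≫ U′ = U′ ≫ G′`. [folklore] -/
private theorem comp_eq_comp_of_conj {A P C Q : 𝒱} (EA : A ≅ P) (EC : C ≅ Q) {u : A ⟶ C} {f : A ⟶ A} {g : C ⟶ C}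
    {U' : P ⟶ Q} {F' : P ⟶ P} {G' : Q ⟶ Q} (hU : U' = EA.inv ≫ u ≫ EC.hom) (hF : F' = EA.inv ≫ f ≫ EA.hom) (hG : G' = EC.inv ≫ g ≫ EC.hom)
    (h : f ≫ u = u ≫ g) : F' ≫ U' = U' ≫ G' := by
  subst hU hF hG
  simp only [Category.assoc, Iso.hom_inv_id_assoc, reassoc_of% h]

/-- If `f′ ≫ E_A = E_A ≫ F`, `g′ ≫ E_C = E_C ≫ G` and `F ≫ U = U ≫ G`, then `f′ ≫ (E_A ≫ U ≫ E_C⁻¹) = (E_A ≫ U ≫ E_C⁻¹) ≫ g′`. [folklore] -/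
private theorem comp_conj_eq_conj_comp {P A Q C : 𝒱} (EA : P ≅ A) (EC : Q ≅ C) {U : A ⟶ C} {F : A ⟶ A} {G : C ⟶ C}
    {f' : P ⟶ P} {g' : Q ⟶ Q} (hF : f' ≫ EA.hom = EA.hom ≫ F) (hG : g' ≫ EC.hom = EC.hom ≫ G) (h : F ≫ U = U ≫ G) :
    f' ≫ (EA.hom ≫ U ≫ EC.inv) = (EA.hom ≫ U ≫ EC.inv) ≫ g' := by
  have hG' : G ≫ EC.inv = EC.inv ≫ g' := by
    have h1 := congrArg (fun φ => EC.inv ≫ φ ≫ EC.inv) hG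
    simp only [Category.assoc, Iso.hom_inv_id, Category.comp_id, Iso.inv_hom_id_assoc] at h1
    exact h1.symm
  rw [reassoc_of% hF, reassoc_of% h, hG']
  simp only [Category.assoc]

/-- Composition of morphisms of abelian varieties, read on the underlying group-scheme morphisms. [folklore] -/
private theorem av_comp_hom_hom_hom {k : Type u} [Field k] {X Y Z : AbelianVariety k} (φ : X ⟶ Y) (ψ : Y ⟶ Z) :
    (φ ≫ ψ).hom.hom.hom = φ.hom.hom.hom ≫ ψ.hom.hom.hom := rfl

/-- For an isomorphism `φ` of abelian varieties, `φ⁻¹(φ(P)) = P` on `L`-points. [folklore] -/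
private theorem map_inv_map_hom {k : Type u} [Field k] {X Y : AbelianVariety k} (φ : X ≅ Y) {L : Type u} [Field L] [Algebra k L]
    (P : AlgPoints X.X L) : AlgPoints.map φ.inv.hom.hom.hom (AlgPoints.map φ.hom.hom.hom.hom P) = P := by
  rw [← AlgPoints.map_comp_apply, AbelianVariety.iso_hom_hom_hom_hom_comp_inv, AlgPoints.map_id_apply]

end Bookkeeping

section Abstract

/-! ### §1 The abstract two-stage setting: a stage hom `U` whose `Ω`-fibre is `u` through the generic five-piece isomorphisms; its special fibre through the special ones -/

variable {T Ug V V' Us : Scheme.{u}} {Ω κ : Type u} [Field Ω] [Field κ]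
  (j : Ug ⟶ T) (z z'' : V ⟶ T) (g : V' ⟶ V) (y y'' : Spec (.of Ω) ⟶ Ug) (a : Spec (.of Ω) ⟶ V) (a' : Spec (.of Ω) ⟶ V')
  (hpt : y ≫ j = a ≫ z) (hpt'' : y'' ≫ j = a ≫ z'') (e : a' ≫ g = a)
  (js : Us ⟶ T) (ys ys'' : Spec (.of κ) ⟶ Us) (b : Spec (.of κ) ⟶ V) (b' : Spec (.of κ) ⟶ V')
  (hspt : ys ≫ js = b ≫ z) (hspt'' : ys'' ≫ js = b ≫ z'') (es : b' ≫ g = b)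
  (𝒜 𝒞 : AbelianSchemeOver T)
  (U : ((𝒜.baseChange z).baseChange g).X ⟶ ((𝒞.baseChange z'').baseChange g).X) [IsMonHom U]
  (u : ((𝒜.baseChange j).baseChange y).X ⟶ ((𝒞.baseChange j).baseChange y'').X) [IsMonHom u]
  [QuasiCompact a'] [IsSchemeTheoreticallyDominant a']
  (hfib : fibreHom U a' =
    (𝒜.fibreBaseChangeIso j y ≪≫ 𝒜.fibreCongrPtIso hpt ≪≫ (𝒜.fibreBaseChangeIso z a).symm ≪≫
        ((𝒜.baseChange z).fibreCongrPtIso e).symm ≪≫ ((𝒜.baseChange z).fibreBaseChangeIso g a').symm).inv ≫ homOfIsMonHom u ≫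
      (𝒞.fibreBaseChangeIso j y'' ≪≫ 𝒞.fibreCongrPtIso hpt'' ≪≫ (𝒞.fibreBaseChangeIso z'' a).symm ≪≫
        ((𝒞.baseChange z'').fibreCongrPtIso e).symm ≪≫ ((𝒞.baseChange z'').fibreBaseChangeIso g a').symm).hom)

include hfib in
/-- **EQUIVARIANCE TRANSFERS FROM THE GENERIC TO THE SPECIAL FIBRE.**  Abstract two-stage setting: `U : (𝒜_z)_{V′} → (𝒞_{z″})_{V′}` a homomorphism over the stage
`V′` whose fibre at the schematically dominant point `a′` is `u` through the generic five-piece isomorphisms (`hfib`); `f`, `g′` endomorphisms of `𝒜`, `𝒞` with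
`f_y ≫ u = u ≫ g′_{y″}`.  Then `F ≫ U = U ≫ G` over `V′` (equal `a′`-fibres, ★ `pullback_map_injective_of_flat`), hence at the special point `b′`, hence — through the special
five-piece isomorphisms (★ (ν6) §1 `fibreHom_comp_alongStageIso_hom`) — `f_{ys} ≫ ū = ū ≫ g′_{ys″}` for `ū := E_𝒜 ≫ U_{b′} ≫ E_𝒞⁻¹`.
[cite: MumfordFogartyKirwan1994, Ch. 6 §1 Corollary 6.2 (p. 116); Ch. 7 §2 Definition 7.2 (p. 129)] [cite: EGAIV3, 11.10.5] -/
theorem baseChangeHom_comp_specialFibre_eq_of_generic (f : 𝒜.X ⟶ 𝒜.X) (g' : 𝒞.X ⟶ 𝒞.X) [IsMonHom f] [IsMonHom g']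
    (hfg : baseChangeHom (baseChangeHom f j) y ≫ u = u ≫ baseChangeHom (baseChangeHom g' j) y'') :
    baseChangeHom (baseChangeHom f js) ys ≫
        ((𝒜.fibreBaseChangeIso js ys ≪≫ 𝒜.fibreCongrPtIso hspt ≪≫ (𝒜.fibreBaseChangeIso z b).symm ≪≫
              ((𝒜.baseChange z).fibreCongrPtIso es).symm ≪≫ ((𝒜.baseChange z).fibreBaseChangeIso g b').symm).hom ≫
            fibreHom U b' ≫
          (𝒞.fibreBaseChangeIso js ys'' ≪≫ 𝒞.fibreCongrPtIso hspt'' ≪≫ (𝒞.fibreBaseChangeIso z'' b).symm ≪≫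
              ((𝒞.baseChange z'').fibreCongrPtIso es).symm ≪≫ ((𝒞.baseChange z'').fibreBaseChangeIso g b').symm).inv).hom.hom.hom =
      ((𝒜.fibreBaseChangeIso js ys ≪≫ 𝒜.fibreCongrPtIso hspt ≪≫ (𝒜.fibreBaseChangeIso z b).symm ≪≫
              ((𝒜.baseChange z).fibreCongrPtIso es).symm ≪≫ ((𝒜.baseChange z).fibreBaseChangeIso g b').symm).hom ≫
            fibreHom U b' ≫
          (𝒞.fibreBaseChangeIso js ys'' ≪≫ 𝒞.fibreCongrPtIso hspt'' ≪≫ (𝒞.fibreBaseChangeIso z'' b).symm ≪≫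
              ((𝒞.baseChange z'').fibreCongrPtIso es).symm ≪≫ ((𝒞.baseChange z'').fibreBaseChangeIso g b').symm).inv).hom.hom.hom ≫
        baseChangeHom (baseChangeHom g' js) ys'' := by
  haveI := isMonHom_baseChangeHom f z
  haveI := isMonHom_baseChangeHom (baseChangeHom f z) g
  haveI := isMonHom_baseChangeHom g' z''
  haveI := isMonHom_baseChangeHom (baseChangeHom g' z'') g
  haveI := isMonHom_baseChangeHom f j
  haveI := isMonHom_baseChangeHom (baseChangeHom f j) y
  haveI := isMonHom_baseChangeHom g' j
  haveI := isMonHom_baseChangeHom (baseChangeHom g' j) y''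
  haveI := isMonHom_baseChangeHom f js
  haveI := isMonHom_baseChangeHom (baseChangeHom f js) ys
  haveI := isMonHom_baseChangeHom g' js
  haveI := isMonHom_baseChangeHom (baseChangeHom g' js) ys''
  haveI : Flat ((𝒜.baseChange z).baseChange g).X.hom := by
    haveI := ((𝒜.baseChange z).baseChange g).isSmooth
    infer_instance
  haveI : IsSeparated ((𝒞.baseChange z'').baseChange g).X.hom := by
    haveI := ((𝒞.baseChange z'').baseChange g).isProper
    infer_instance
  -- the hypothesis, read on abelian varieties
  have hAV : fibreHom (baseChangeHom f j) y ≫ homOfIsMonHom u = homOfIsMonHom u ≫ fibreHom (baseChangeHom g' j) y'' :=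
    AbelianVariety.hom_ext _ _ hfg
  -- naturality of the generic five-piece isomorphisms (★ (ν6) §1)
  have nA := (Iso.eq_inv_comp _).2 (fibreHom_comp_alongStageIso_hom j z g y a a' hpt e 𝒜 𝒜 f).symm
  have nC := (Iso.eq_inv_comp _).2 (fibreHom_comp_alongStageIso_hom j z'' g y'' a a' hpt'' e 𝒞 𝒞 g').symm
  -- Step A: over the stage `V′`, `F ≫ U = U ≫ G` (the two sides have the same `a′`-fibre)
  have hA : baseChangeHom (baseChangeHom f z) g ≫ U = U ≫ baseChangeHom (baseChangeHom g' z'') g := by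
    have key : fibreHom (baseChangeHom (baseChangeHom f z) g ≫ U) a' = fibreHom (U ≫ baseChangeHom (baseChangeHom g' z'') g) a' := by
      rw [fibreHom_comp, fibreHom_comp]
      exact comp_eq_comp_of_conj _ _ hfib nA nC hAV  -- `E_A := five𝒜`, `E_C := five𝒞` (first-order from `hfib`)
    have key' : (Over.pullback a').map (baseChangeHom (baseChangeHom f z) g ≫ U) = (Over.pullback a').map (U ≫ baseChangeHom (baseChangeHom g' z'') g) := by
      rw [← fibreHom_hom_hom_hom, ← fibreHom_hom_hom_hom, key]
    exact Literature.AlgebraicGeometry.Limits.pullback_map_injective_of_flat a' key'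
  -- Step B: the special fibre at `b′`, through the special five-piece isomorphisms
  have hB : fibreHom (baseChangeHom (baseChangeHom f z) g) b' ≫ fibreHom U b' = fibreHom U b' ≫ fibreHom (baseChangeHom (baseChangeHom g' z'') g) b' := by
    rw [← fibreHom_comp, ← fibreHom_comp]
    exact AbelianVariety.hom_ext _ _ (by rw [fibreHom_hom_hom_hom, fibreHom_hom_hom_hom, hA])
  have nAs := fibreHom_comp_alongStageIso_hom js z g ys b b' hspt es 𝒜 𝒜 f
  have nCs := fibreHom_comp_alongStageIso_hom js z'' g ys'' b b' hspt'' es 𝒞 𝒞 g'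
  have hSpec := congrArg (fun φ => φ.hom.hom.hom) (comp_conj_eq_conj_comp _ _ nAs nCs hB)
  simp only [AbelianVariety.comp_hom] at hSpec
  exact hSpec


omit [QuasiCompact a'] in
include hfib in
/-- **IDENTITIES OF SECTION VALUES TRANSFER FROM THE GENERIC TO THE SPECIAL FIBRE.**  In the abstract two-stage setting of
`baseChangeHom_comp_specialFibre_eq_of_generic`: for sections `τ` of `𝒜` and `τ″` of `𝒞` with `u(τ(y)) = τ″(y″)`, the stage sections `τ_{V′} ≫ U` and `τ″_{V′}`
agree at `a′` (★ (ν6) §1 `map_alongStageIso_restrictPt`, ★ `map_fibreHom_restrictPt`), hence are EQUAL (sections of a separated scheme agreeing on a schematically dominant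
point, ★ `ext_of_isSchemeTheoreticallyDominant_of_isSeparated`), hence agree at `b′`; read through the special five-piece isomorphisms: `ū(τ(ys)) = τ″(ys″)`.
[cite: MumfordFogartyKirwan1994, Ch. 7 §2 Definitions 7.1–7.2 (p. 129)] [cite: EGAIV3, 11.10.5] -/
theorem map_specialFibre_restrictPt_eq_of_generic (τ : 𝒜.Sections) (τ'' : 𝒞.Sections)
    (hτ : AlgPoints.map u ((𝒜.baseChange j).restrictPt y (𝒜.sectionBaseChange j τ)) = (𝒞.baseChange j).restrictPt y'' (𝒞.sectionBaseChange j τ'')) :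
    AlgPoints.map ((𝒜.fibreBaseChangeIso js ys ≪≫ 𝒜.fibreCongrPtIso hspt ≪≫ (𝒜.fibreBaseChangeIso z b).symm ≪≫ ((𝒜.baseChange z).fibreCongrPtIso es).symm ≪≫ ((𝒜.baseChange z).fibreBaseChangeIso g b').symm).hom ≫ fibreHom U b' ≫ (𝒞.fibreBaseChangeIso js ys'' ≪≫ 𝒞.fibreCongrPtIso hspt'' ≪≫ (𝒞.fibreBaseChangeIso z'' b).symm ≪≫ ((𝒞.baseChange z'').fibreCongrPtIso es).symm ≪≫ ((𝒞.baseChange z'').fibreBaseChangeIso g b').symm).inv).hom.hom.hom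
        ((𝒜.baseChange js).restrictPt ys (𝒜.sectionBaseChange js τ)) = (𝒞.baseChange js).restrictPt ys'' (𝒞.sectionBaseChange js τ'') := by
  haveI : IsSeparated ((𝒞.baseChange z'').baseChange g).X.hom := by
    haveI := ((𝒞.baseChange z'').baseChange g).isProper
    infer_instance
  -- the generic values through the five-piece isomorphisms (★ (ν6) §1)
  have gA := map_alongStageIso_restrictPt j z g y a a' hpt e 𝒜 τ
  have gC := map_alongStageIso_restrictPt j z'' g y'' a a' hpt'' e 𝒞 τ''
  -- Step A: the stage sections `τ_{V′} ≫ U` and `τ″_{V′}` agree at `a′` …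
  have hA0 : ((𝒞.baseChange z'').baseChange g).restrictPt a'
        ((𝒜.baseChange z).sectionBaseChange g (𝒜.sectionBaseChange z τ) ≫ U) =
      ((𝒞.baseChange z'').baseChange g).restrictPt a' ((𝒞.baseChange z'').sectionBaseChange g (𝒞.sectionBaseChange z'' τ'')) := by
    rw [← map_fibreHom_restrictPt a' U, hfib, ← gA, ← gC, ← hτ, av_comp_hom_hom_hom, av_comp_hom_hom_hom, homOfIsMonHom_hom,
      AlgPoints.map_comp_apply, AlgPoints.map_comp_apply, map_inv_map_hom]
  -- … hence are equal
  have hA : (𝒜.baseChange z).sectionBaseChange g (𝒜.sectionBaseChange z τ) ≫ U =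
      (𝒞.baseChange z'').sectionBaseChange g (𝒞.sectionBaseChange z'' τ'') := by
    have h1 := congrArg (fun P => CommaMorphism.left P) (((restrictPt_eq_restrictPt_iff _ a' _ _).1 hA0))
    simp only [restrict_left] at h1
    ext : 1
    exact Literature.AlgebraicGeometry.Limits.ext_of_isSchemeTheoreticallyDominant_of_isSeparated ((𝒞.baseChange z'').baseChange g).X.hom
      ((Over.w _).trans (Over.w _).symm) a' h1
  -- Step B: the special values
  have sA := map_alongStageIso_restrictPt js z g ys b b' hspt es 𝒜 τ
  have sC := map_alongStageIso_restrictPt js z'' g ys'' b b' hspt'' es 𝒞 τ''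
  rw [av_comp_hom_hom_hom, av_comp_hom_hom_hom, AlgPoints.map_comp_apply, AlgPoints.map_comp_apply, sA, map_fibreHom_restrictPt b' U, hA, ← sC,
    map_inv_map_hom]

omit [QuasiCompact a'] [IsSchemeTheoreticallyDominant a'] in
include hfib in
/-- **A POLARISATION LAW IN DUAL-HOMOMORPHISM FORM TRANSFERS FROM THE GENERIC TO THE SPECIAL FIBRE.**  In the abstract two-stage setting, with the
stage `V′` connected, reduced and locally Noetherian (the spectrum of a Dedekind domain): if `u ≫ (λ_𝒞)_{y″} ≫ u^∨ = (λ_𝒜)_y ≫ [n]`, then the same law holds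
for `U_{a′}` (transport along the `λ`-exact generic five-piece isomorphisms, ★ (G-λ) §4∕§2), hence for `U` over `V′` (★ (G-λ) §1: decided at one field point),
hence for `U_{b′}` (★ `DualPair.baseChangeHom_similitude_base`), hence for `ū` (transport along the special five-piece isomorphisms).
[cite: MumfordFogartyKirwan1994, Ch. 6 §1 Corollary 6.2 (p. 116) and Corollary 6.8 (p. 118)] [cite: MumfordAV1970, §15 Thm. 1 (p. 143)] -/
theorem specialFibre_comp_lam_comp_dualIsogenyOver_eq_of_generic [IsLocallyNoetherian V'] [PreconnectedSpace V'] [IsReduced V']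
    (D𝒜 : 𝒜.DualPair) (pol𝒜 : 𝒜.Polarization D𝒜) (D𝒞 : 𝒞.DualPair) (pol𝒞 : 𝒞.Polarization D𝒞) (n : ℕ)
    (hlam : u ≫ ((pol𝒞.baseChange j).baseChange y'').lam ≫
        DualPair.dualIsogenyOver u ((D𝒜.baseChange j).baseChange y) ((D𝒞.baseChange j).baseChange y'') =
      ((pol𝒜.baseChange j).baseChange y).lam ≫ ((D𝒜.baseChange j).baseChange y).hat.mulN n) :
    ((𝒜.fibreBaseChangeIso js ys ≪≫ 𝒜.fibreCongrPtIso hspt ≪≫ (𝒜.fibreBaseChangeIso z b).symm ≪≫ ((𝒜.baseChange z).fibreCongrPtIso es).symm ≪≫ ((𝒜.baseChange z).fibreBaseChangeIso g b').symm).hom ≫ fibreHom U b' ≫ (𝒞.fibreBaseChangeIso js ys'' ≪≫ 𝒞.fibreCongrPtIso hspt'' ≪≫ (𝒞.fibreBaseChangeIso z'' b).symm ≪≫ ((𝒞.baseChange z'').fibreCongrPtIso es).symm ≪≫ ((𝒞.baseChange z'').fibreBaseChangeIso g b').symm).inv).hom.hom.hom ≫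
        ((pol𝒞.baseChange js).baseChange ys'').lam ≫
        @DualPair.dualIsogenyOver _ ((𝒜.baseChange js).baseChange ys) ((𝒞.baseChange js).baseChange ys'') ((𝒜.fibreBaseChangeIso js ys ≪≫ 𝒜.fibreCongrPtIso hspt ≪≫ (𝒜.fibreBaseChangeIso z b).symm ≪≫ ((𝒜.baseChange z).fibreCongrPtIso es).symm ≪≫ ((𝒜.baseChange z).fibreBaseChangeIso g b').symm).hom ≫ fibreHom U b' ≫ (𝒞.fibreBaseChangeIso js ys'' ≪≫ 𝒞.fibreCongrPtIso hspt'' ≪≫ (𝒞.fibreBaseChangeIso z'' b).symm ≪≫ ((𝒞.baseChange z'').fibreCongrPtIso es).symm ≪≫ ((𝒞.baseChange z'').fibreBaseChangeIso g b').symm).inv).hom.hom.hom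
          ((𝒜.fibreBaseChangeIso js ys ≪≫ 𝒜.fibreCongrPtIso hspt ≪≫ (𝒜.fibreBaseChangeIso z b).symm ≪≫ ((𝒜.baseChange z).fibreCongrPtIso es).symm ≪≫ ((𝒜.baseChange z).fibreBaseChangeIso g b').symm).hom ≫ fibreHom U b' ≫ (𝒞.fibreBaseChangeIso js ys'' ≪≫ 𝒞.fibreCongrPtIso hspt'' ≪≫ (𝒞.fibreBaseChangeIso z'' b).symm ≪≫ ((𝒞.baseChange z'').fibreCongrPtIso es).symm ≪≫ ((𝒞.baseChange z'').fibreBaseChangeIso g b').symm).inv).hom.hom.isMonHom_hom ((D𝒜.baseChange js).baseChange ys) ((D𝒞.baseChange js).baseChange ys'') =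
      ((pol𝒜.baseChange js).baseChange ys).lam ≫ ((D𝒜.baseChange js).baseChange ys).hat.mulN n := by
  -- the underlying isomorphisms of group schemes of the four five-piece isomorphisms
  haveI := (𝒜.fibreBaseChangeIso j y ≪≫ 𝒜.fibreCongrPtIso hpt ≪≫ (𝒜.fibreBaseChangeIso z a).symm ≪≫ ((𝒜.baseChange z).fibreCongrPtIso e).symm ≪≫ ((𝒜.baseChange z).fibreBaseChangeIso g a').symm).hom.hom.hom.isMonHom_hom
  haveI := (𝒞.fibreBaseChangeIso j y'' ≪≫ 𝒞.fibreCongrPtIso hpt'' ≪≫ (𝒞.fibreBaseChangeIso z'' a).symm ≪≫ ((𝒞.baseChange z'').fibreCongrPtIso e).symm ≪≫ ((𝒞.baseChange z'').fibreBaseChangeIso g a').symm).hom.hom.hom.isMonHom_hom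
  haveI := (𝒜.fibreBaseChangeIso js ys ≪≫ 𝒜.fibreCongrPtIso hspt ≪≫ (𝒜.fibreBaseChangeIso z b).symm ≪≫ ((𝒜.baseChange z).fibreCongrPtIso es).symm ≪≫ ((𝒜.baseChange z).fibreBaseChangeIso g b').symm).hom.hom.hom.isMonHom_hom
  haveI := (𝒞.fibreBaseChangeIso js ys'' ≪≫ 𝒞.fibreCongrPtIso hspt'' ≪≫ (𝒞.fibreBaseChangeIso z'' b).symm ≪≫ ((𝒞.baseChange z'').fibreCongrPtIso es).symm ≪≫ ((𝒞.baseChange z'').fibreBaseChangeIso g b').symm).hom.hom.hom.isMonHom_hom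
  haveI := isMonHom_baseChangeHom U a'
  haveI := isMonHom_baseChangeHom U b'
  haveI := ((pol𝒜.baseChange j).baseChange y).isMonHom
  haveI := ((pol𝒞.baseChange j).baseChange y'').isMonHom
  haveI := ((pol𝒜.baseChange z).baseChange g).isMonHom
  haveI := ((pol𝒞.baseChange z'').baseChange g).isMonHom
  haveI := (((pol𝒜.baseChange z).baseChange g).baseChange a').isMonHom
  haveI := (((pol𝒞.baseChange z'').baseChange g).baseChange a').isMonHom
  haveI := (((pol𝒜.baseChange z).baseChange g).baseChange b').isMonHom
  haveI := (((pol𝒞.baseChange z'').baseChange g).baseChange b').isMonHom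
  haveI := ((pol𝒜.baseChange js).baseChange ys).isMonHom
  haveI := ((pol𝒞.baseChange js).baseChange ys'').isMonHom
  -- the unit normalisations of all the dual pairs involved (★ `Polarization.nonempty_unitHatSlice_iso`)
  have hDAη := ((pol𝒜.baseChange j).baseChange y).nonempty_unitHatSlice_iso
  have hDCη := ((pol𝒞.baseChange j).baseChange y'').nonempty_unitHatSlice_iso
  have hDAV := ((pol𝒜.baseChange z).baseChange g).nonempty_unitHatSlice_iso
  have hDCV := ((pol𝒞.baseChange z'').baseChange g).nonempty_unitHatSlice_iso
  have hDAa := (((pol𝒜.baseChange z).baseChange g).baseChange a').nonempty_unitHatSlice_iso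
  have hDCa := (((pol𝒞.baseChange z'').baseChange g).baseChange a').nonempty_unitHatSlice_iso
  have hDAb := (((pol𝒜.baseChange z).baseChange g).baseChange b').nonempty_unitHatSlice_iso
  have hDCb := (((pol𝒞.baseChange z'').baseChange g).baseChange b').nonempty_unitHatSlice_iso
  have hDAκ := ((pol𝒜.baseChange js).baseChange ys).nonempty_unitHatSlice_iso
  have hDCκ := ((pol𝒞.baseChange js).baseChange ys'').nonempty_unitHatSlice_iso
  -- `λ`-exactness of the five-piece isomorphisms (★ (G-λ) §4)
  have xAg := alongStageIso_hom_comp_lam_comp_dualIsogenyOver j z g y a a' hpt e 𝒜 D𝒜 pol𝒜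
  have xCg := alongStageIso_hom_comp_lam_comp_dualIsogenyOver j z'' g y'' a a' hpt'' e 𝒞 D𝒞 pol𝒞
  have xAs := alongStageIso_hom_comp_lam_comp_dualIsogenyOver js z g ys b b' hspt es 𝒜 D𝒜 pol𝒜
  have xCs := alongStageIso_hom_comp_lam_comp_dualIsogenyOver js z'' g ys'' b b' hspt'' es 𝒞 D𝒞 pol𝒞
  -- Step A1: `u = E_𝒜 ≫ U_{a′} ≫ E_𝒞⁻¹` on group schemes
  have huAV : (𝒜.fibreBaseChangeIso j y ≪≫ 𝒜.fibreCongrPtIso hpt ≪≫ (𝒜.fibreBaseChangeIso z a).symm ≪≫ ((𝒜.baseChange z).fibreCongrPtIso e).symm ≪≫ ((𝒜.baseChange z).fibreBaseChangeIso g a').symm).hom ≫ fibreHom U a' ≫ (𝒞.fibreBaseChangeIso j y'' ≪≫ 𝒞.fibreCongrPtIso hpt'' ≪≫ (𝒞.fibreBaseChangeIso z'' a).symm ≪≫ ((𝒞.baseChange z'').fibreCongrPtIso e).symm ≪≫ ((𝒞.baseChange z'').fibreBaseChangeIso g a').symm).inv = homOfIsMonHom u := by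
    rw [hfib]; simp only [Category.assoc, Iso.hom_inv_id_assoc, Iso.hom_inv_id, Category.comp_id]
  have hu : (𝒜.fibreBaseChangeIso j y ≪≫ 𝒜.fibreCongrPtIso hpt ≪≫ (𝒜.fibreBaseChangeIso z a).symm ≪≫ ((𝒜.baseChange z).fibreCongrPtIso e).symm ≪≫ ((𝒜.baseChange z).fibreBaseChangeIso g a').symm).hom.hom.hom.hom ≫ baseChangeHom U a' ≫ (𝒞.fibreBaseChangeIso j y'' ≪≫ 𝒞.fibreCongrPtIso hpt'' ≪≫ (𝒞.fibreBaseChangeIso z'' a).symm ≪≫ ((𝒞.baseChange z'').fibreCongrPtIso e).symm ≪≫ ((𝒞.baseChange z'').fibreBaseChangeIso g a').symm).inv.hom.hom.hom = u := by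
    have h1 := congrArg (fun φ => φ.hom.hom.hom) huAV
    rw [av_comp_hom_hom_hom, av_comp_hom_hom_hom, fibreHom_hom_hom_hom, homOfIsMonHom_hom] at h1
    exact h1
  -- Step A2: the law for `U_{a′}` (★ (G-λ) §2, transport along the generic five-piece isomorphisms)
  have hUa : baseChangeHom U a' ≫ baseChangeHom ((pol𝒞.baseChange z'').baseChange g).lam a' ≫
        @DualPair.dualIsogenyOver _ _ _ (baseChangeHom U a') (isMonHom_baseChangeHom U a')
          (((D𝒜.baseChange z).baseChange g).baseChange a') (((D𝒞.baseChange z'').baseChange g).baseChange a') =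
      baseChangeHom ((pol𝒜.baseChange z).baseChange g).lam a' ≫ (((D𝒜.baseChange z).baseChange g).baseChange a').hat.mulN n := by
    refine (comp_lam_comp_dualIsogenyOver_eq_mulN_iff_of_iso (((D𝒜.baseChange z).baseChange g).baseChange a') ((D𝒜.baseChange j).baseChange y)
      (((D𝒞.baseChange z'').baseChange g).baseChange a') ((D𝒞.baseChange j).baseChange y'') hDAa hDAη hDCa
      (((pol𝒜.baseChange z).baseChange g).baseChange a').lam ((pol𝒜.baseChange j).baseChange y).lam
      (((pol𝒞.baseChange z'').baseChange g).baseChange a').lam ((pol𝒞.baseChange j).baseChange y'').lam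
      ⟨(𝒜.fibreBaseChangeIso j y ≪≫ 𝒜.fibreCongrPtIso hpt ≪≫ (𝒜.fibreBaseChangeIso z a).symm ≪≫ ((𝒜.baseChange z).fibreCongrPtIso e).symm ≪≫ ((𝒜.baseChange z).fibreBaseChangeIso g a').symm).hom.hom.hom.hom, (𝒜.fibreBaseChangeIso j y ≪≫ 𝒜.fibreCongrPtIso hpt ≪≫ (𝒜.fibreBaseChangeIso z a).symm ≪≫ ((𝒜.baseChange z).fibreCongrPtIso e).symm ≪≫ ((𝒜.baseChange z).fibreBaseChangeIso g a').symm).inv.hom.hom.hom, AbelianVariety.iso_hom_hom_hom_hom_comp_inv _, AbelianVariety.iso_inv_hom_hom_hom_comp_hom _⟩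
      ⟨(𝒞.fibreBaseChangeIso j y'' ≪≫ 𝒞.fibreCongrPtIso hpt'' ≪≫ (𝒞.fibreBaseChangeIso z'' a).symm ≪≫ ((𝒞.baseChange z'').fibreCongrPtIso e).symm ≪≫ ((𝒞.baseChange z'').fibreBaseChangeIso g a').symm).hom.hom.hom.hom, (𝒞.fibreBaseChangeIso j y'' ≪≫ 𝒞.fibreCongrPtIso hpt'' ≪≫ (𝒞.fibreBaseChangeIso z'' a).symm ≪≫ ((𝒞.baseChange z'').fibreCongrPtIso e).symm ≪≫ ((𝒞.baseChange z'').fibreBaseChangeIso g a').symm).inv.hom.hom.hom, AbelianVariety.iso_hom_hom_hom_hom_comp_inv _, AbelianVariety.iso_inv_hom_hom_hom_comp_hom _⟩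
      (baseChangeHom U a') n xAg xCg).2 ?_
    rw [DualPair.dualIsogenyOver_congr ((D𝒜.baseChange j).baseChange y) ((D𝒞.baseChange j).baseChange y'') hu, hu]
    exact hlam
  -- Step A3: the law over the stage `V′` (★ (G-λ) §1: decided at the field point `a′`)
  have hV := comp_lam_comp_dualIsogenyOver_eq_mulN_of_baseChangeHom ((D𝒜.baseChange z).baseChange g) ((D𝒞.baseChange z'').baseChange g) hDAV hDCV U
    ((pol𝒜.baseChange z).baseChange g).lam ((pol𝒞.baseChange z'').baseChange g).lam n a' hUa
  -- Step B1: the law for `U_{b′}`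
  have hUb := DualPair.baseChangeHom_similitude_base b' U ((D𝒜.baseChange z).baseChange g) ((D𝒞.baseChange z'').baseChange g)
    ((pol𝒜.baseChange z).baseChange g).lam ((pol𝒞.baseChange z'').baseChange g).lam n hV
  -- Step B2: transport along the special five-piece isomorphisms
  have hUB : ((𝒜.fibreBaseChangeIso js ys ≪≫ 𝒜.fibreCongrPtIso hspt ≪≫ (𝒜.fibreBaseChangeIso z b).symm ≪≫ ((𝒜.baseChange z).fibreCongrPtIso es).symm ≪≫ ((𝒜.baseChange z).fibreBaseChangeIso g b').symm).hom ≫ fibreHom U b' ≫ (𝒞.fibreBaseChangeIso js ys'' ≪≫ 𝒞.fibreCongrPtIso hspt'' ≪≫ (𝒞.fibreBaseChangeIso z'' b).symm ≪≫ ((𝒞.baseChange z'').fibreCongrPtIso es).symm ≪≫ ((𝒞.baseChange z'').fibreBaseChangeIso g b').symm).inv).hom.hom.hom = (𝒜.fibreBaseChangeIso js ys ≪≫ 𝒜.fibreCongrPtIso hspt ≪≫ (𝒜.fibreBaseChangeIso z b).symm ≪≫ ((𝒜.baseChange z).fibreCongrPtIso es).symm ≪≫ ((𝒜.baseChange z).fibreBaseChangeIso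 g b').symm).hom.hom.hom.hom ≫ baseChangeHom U b' ≫ (𝒞.fibreBaseChangeIso js ys'' ≪≫ 𝒞.fibreCongrPtIso hspt'' ≪≫ (𝒞.fibreBaseChangeIso z'' b).symm ≪≫ ((𝒞.baseChange z'').fibreCongrPtIso es).symm ≪≫ ((𝒞.baseChange z'').fibreBaseChangeIso g b').symm).inv.hom.hom.hom := by
    rw [av_comp_hom_hom_hom, av_comp_hom_hom_hom, fibreHom_hom_hom_hom]
  have key := (comp_lam_comp_dualIsogenyOver_eq_mulN_iff_of_iso (((D𝒜.baseChange z).baseChange g).baseChange b') ((D𝒜.baseChange js).baseChange ys)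
      (((D𝒞.baseChange z'').baseChange g).baseChange b') ((D𝒞.baseChange js).baseChange ys'') hDAb hDAκ hDCb
      (((pol𝒜.baseChange z).baseChange g).baseChange b').lam ((pol𝒜.baseChange js).baseChange ys).lam
      (((pol𝒞.baseChange z'').baseChange g).baseChange b').lam ((pol𝒞.baseChange js).baseChange ys'').lam
      ⟨(𝒜.fibreBaseChangeIso js ys ≪≫ 𝒜.fibreCongrPtIso hspt ≪≫ (𝒜.fibreBaseChangeIso z b).symm ≪≫ ((𝒜.baseChange z).fibreCongrPtIso es).symm ≪≫ ((𝒜.baseChange z).fibreBaseChangeIso g b').symm).hom.hom.hom.hom, (𝒜.fibreBaseChangeIso js ys ≪≫ 𝒜.fibreCongrPtIso hspt ≪≫ (𝒜.fibreBaseChangeIso z b).symm ≪≫ ((𝒜.baseChange z).fibreCongrPtIso es).symm ≪≫ ((𝒜.baseChange z).fibreBaseChangeIso g b').symm).inv.hom.hom.hom, AbelianVariety.iso_hom_hom_hom_hom_comp_inv _, AbelianVariety.iso_inv_hom_hom_hom_comp_hom _⟩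
      ⟨(𝒞.fibreBaseChangeIso js ys'' ≪≫ 𝒞.fibreCongrPtIso hspt'' ≪≫ (𝒞.fibreBaseChangeIso z'' b).symm ≪≫ ((𝒞.baseChange z'').fibreCongrPtIso es).symm ≪≫ ((𝒞.baseChange z'').fibreBaseChangeIso g b').symm).hom.hom.hom.hom, (𝒞.fibreBaseChangeIso js ys'' ≪≫ 𝒞.fibreCongrPtIso hspt'' ≪≫ (𝒞.fibreBaseChangeIso z'' b).symm ≪≫ ((𝒞.baseChange z'').fibreCongrPtIso es).symm ≪≫ ((𝒞.baseChange z'').fibreBaseChangeIso g b').symm).inv.hom.hom.hom, AbelianVariety.iso_hom_hom_hom_hom_comp_inv _, AbelianVariety.iso_inv_hom_hom_hom_comp_hom _⟩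
      (baseChangeHom U b') n xAs xCs).1 hUb
  rw [DualPair.dualIsogenyOver_congr ((D𝒜.baseChange js).baseChange ys) ((D𝒞.baseChange js).baseChange ys'') hUB, hUB]
  exact key

end Abstract

section Head

variable {K : Type} [Field K] [NumberField K] {v : HeightOneSpectrum (𝓞 K)} {Y : SchemeOver K}
  (𝓨 : IntegralModel (valuationSubringAtPrime K v) K Y) [IsProper 𝓨.total.hom]
  (𝒜 𝒞 : AbelianSchemeOver 𝓨.total.left) (x x'' : AlgPoints Y (AlgebraicClosure (v.adicCompletion K)))

set_option maxHeartbeats 400000 in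
/-- **THE SPECIAL FIBRE OF THE REDUCTION OF A HOMOMORPHISM BETWEEN FIBRE TUPLES, WITH ITS FOUR TRANSFERS.**  `𝓨` a proper model at `v`, `𝒜, 𝒞 → 𝓨` abelian
schemes, `x, x″ ∈ Y(Ω)`, `u : (𝒜_η)_x → (𝒞_η)_{x″}` a homomorphism of the generic fibre tuples (iterated base change along `ι_η` then the point).  THEN there is a
HOMOMORPHISM `ū : (𝒜_s)_{x̄} → (𝒞_s)_{x̄″}` between the special fibre tuples at `x̄ = red x`, `x̄″ = red x″` (★ `IntegralModel.geomReductionMap`; iterated base change along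
`ι_s` then the point) such that: (i) if `u` is finite and surjective then `ū` is flat and surjective; (ii) for every pair of endomorphisms `f` of `𝒜`, `g` of `𝒞` with
`f_x ≫ u = u ≫ g_{x″}` also `f_{x̄} ≫ ū = ū ≫ g_{x̄″}`; (iii) for every pair of sections `τ` of `𝒜`, `τ″` of `𝒞` with `u(τ(x)) = τ″(x″)` also `ū(τ(x̄)) = τ″(x̄″)`; (iv) for dual
pairs and polarisations `(D_𝒜, λ_𝒜)`, `(D_𝒞, λ_𝒞)` and `n ∈ ℕ` with `u ≫ (λ_𝒞)_{x″} ≫ u^∨ = (λ_𝒜)_x ≫ [n]` also `ū ≫ (λ_𝒞)_{x̄″} ≫ ū^∨ = (λ_𝒜)_{x̄} ≫ [n]`.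
(★ (ν7) turnkey; (ii)–(iv): equal `Ω`-fibres ⇒ equal over the refined stage ⇒ equal special fibres, transported along the five-piece isomorphisms of ★ (ν6) §1 ∕ ★ (G-λ) §4;
(i): ★ (ν7)'s isogeny clause + ★ `flat_left_of_isFinite_of_surjective`.) [cite: SerreTate1968, §1] [cite: BoschLutkebohmertRaynaud1990, §1.2 Prop. 8 and §7.3 Prop. 6 (p. 180)]
[cite: MumfordFogartyKirwan1994, Ch. 6 §1 Corollary 6.2 (p. 116); Ch. 7 §2 Definition 7.2 (p. 129)] [cite: MumfordAV1970, §15 Thm. 1 (p. 143)] -/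
theorem exists_specialFibre_hom_reduction
    (u : ((𝒜.baseChange (𝓨.genericIso'.inv.left ≫ pullback.fst 𝓨.total.hom (specGenericPoint (valuationSubringAtPrime K v) K))).baseChange x.left).X ⟶
         ((𝒞.baseChange (𝓨.genericIso'.inv.left ≫ pullback.fst 𝓨.total.hom (specGenericPoint (valuationSubringAtPrime K v) K))).baseChange x''.left).X)
    [IsMonHom u] :
    ∃ (ubar : ((𝒜.baseChange (pullback.fst 𝓨.total.hom (specResidueField v))).baseChange (𝓨.geomReductionMap x).left).X ⟶
               ((𝒞.baseChange (pullback.fst 𝓨.total.hom (specResidueField v))).baseChange (𝓨.geomReductionMap x'').left).X) (_ : IsMonHom ubar),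
      -- (i) finite surjective ⇒ flat surjective
      (IsFinite u.left → Surjective u.left → Flat ubar.left ∧ Function.Surjective ubar.left.base) ∧
      -- (ii) equivariance for endomorphism pairs transfers
      (∀ (f : 𝒜.X ⟶ 𝒜.X) (g : 𝒞.X ⟶ 𝒞.X) [IsMonHom f] [IsMonHom g],
        baseChangeHom (baseChangeHom f _) x.left ≫ u = u ≫ baseChangeHom (baseChangeHom g _) x''.left →
        baseChangeHom (baseChangeHom f (pullback.fst 𝓨.total.hom (specResidueField v))) (𝓨.geomReductionMap x).left ≫ ubar =
          ubar ≫ baseChangeHom (baseChangeHom g (pullback.fst 𝓨.total.hom (specResidueField v))) (𝓨.geomReductionMap x'').left) ∧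
      -- (iii) identities of section values transfer
      (∀ (τ : 𝒜.Sections) (τ'' : 𝒞.Sections),
        AlgPoints.map u ((𝒜.baseChange _).restrictPt x.left (𝒜.sectionBaseChange _ τ)) =
          (𝒞.baseChange _).restrictPt x''.left (𝒞.sectionBaseChange _ τ'') →
        AlgPoints.map ubar ((𝒜.baseChange (pullback.fst 𝓨.total.hom (specResidueField v))).restrictPt (𝓨.geomReductionMap x).left
            (𝒜.sectionBaseChange _ τ)) =
          (𝒞.baseChange (pullback.fst 𝓨.total.hom (specResidueField v))).restrictPt (𝓨.geomReductionMap x'').left (𝒞.sectionBaseChange _ τ'')) ∧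
      -- (iv) a polarisation law in dual-homomorphism form transfers
      (∀ (D𝒜 : 𝒜.DualPair) (pol𝒜 : 𝒜.Polarization D𝒜) (D𝒞 : 𝒞.DualPair) (pol𝒞 : 𝒞.Polarization D𝒞) (n : ℕ),
        u ≫ ((pol𝒞.baseChange _).baseChange x''.left).lam ≫ DualPair.dualIsogenyOver u ((D𝒜.baseChange _).baseChange x.left) ((D𝒞.baseChange _).baseChange x''.left) =
          ((pol𝒜.baseChange _).baseChange x.left).lam ≫ ((D𝒜.baseChange _).baseChange x.left).hat.mulN n →
        ubar ≫ ((pol𝒞.baseChange (pullback.fst 𝓨.total.hom (specResidueField v))).baseChange (𝓨.geomReductionMap x'').left).lam ≫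
            DualPair.dualIsogenyOver ubar ((D𝒜.baseChange (pullback.fst 𝓨.total.hom (specResidueField v))).baseChange (𝓨.geomReductionMap x).left)
              ((D𝒞.baseChange (pullback.fst 𝓨.total.hom (specResidueField v))).baseChange (𝓨.geomReductionMap x'').left) =
          ((pol𝒜.baseChange (pullback.fst 𝓨.total.hom (specResidueField v))).baseChange (𝓨.geomReductionMap x).left).lam ≫
            ((D𝒜.baseChange (pullback.fst 𝓨.total.hom (specResidueField v))).baseChange (𝓨.geomReductionMap x).left).hat.mulN n) := by
  -- the homomorphism of abelian varieties underlying `u`, and the TURNKEY reduction ★ (ν7)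
  obtain ⟨D, _i1, _i2, L, _i3, _i4, _i5, _i6, _i7, _i8, gD, h, hh, hgD, ha, z, z'', hz, hz'', L', _j1, _j2, _j3, _j4, _j5, χ, h', U, hU,
      hpt, hpt'', e, hspt, hspt'', et, hχ, hh', hh'h, hDed, hFrac, hfib, huniq, hisog⟩ :=
    exists_stage_hom_reduction_turnkey 𝓨 𝒜 𝒞 x x'' (homOfIsMonHom u)
  haveI := hDed
  haveI := hFrac
  haveI := hU
  -- injectivity of restriction to the `Ω`-point `ξ′` of the refined stage (schematically dominant: `D′ → Ω` injective)
  have h'inj : Function.Injective h' := by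
    intro a b hab
    have h1 : χ (a : L') = χ (b : L') := by rw [← hh', ← hh', hab]
    exact Subtype.ext (hχ h1)
  haveI : IsDominant (specGenericPoint (closureValuationSubring (v.adicCompletion K)) (AlgebraicClosure (v.adicCompletion K)) ≫ Spec.map (CommRingCat.ofHom h')) := by
    haveI := isDominant_specMap_of_injective
      (algebraMap (closureValuationSubring (v.adicCompletion K)) (AlgebraicClosure (v.adicCompletion K))) Subtype.val_injective
    haveI := isDominant_specMap_of_injective h' h'inj
    infer_instance
  haveI : IsSchemeTheoreticallyDominant (specGenericPoint (closureValuationSubring (v.adicCompletion K)) (AlgebraicClosure (v.adicCompletion K)) ≫ Spec.map (CommRingCat.ofHom h')) := IsSchemeTheoreticallyDominant.of_isDominant _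
  -- the special fibre of `U`, transported along the special five-piece along-stage isomorphisms (★ (ν6) §1 shape at `j := ι_s`, `y := x̄`, `a := cp ≫ Spec h`,
  -- `a′ := t′ := cp ≫ Spec h′`, `hpt := hspt`, `e := et`; `cp : Spec κ̄ → Spec R` the geometric closed point of `R`): `ū := E_𝒜 ≫ U_{t′} ≫ E_𝒞⁻¹`, written literally
  refine ⟨((𝒜.fibreBaseChangeIso (pullback.fst 𝓨.total.hom (specResidueField v)) (𝓨.geomReductionMap x).left ≪≫ 𝒜.fibreCongrPtIso hspt ≪≫ (𝒜.fibreBaseChangeIso z.left (((geomClosedPointIsoSpecResidueField v).inv.left ≫ (specRingHomι (closureValuationSubring (v.adicCompletion K)) (toClosureValuationSubring v) (IsLocalRing.residue (closureValuationSubring (v.adicCompletion K)))).left) ≫ Spec.map (CommRingCat.ofHom h))).symm ≪≫ ((𝒜.baseChange z.left).fibreCongrPtIso et).symm ≪≫ ((𝒜.baseChange z.left).fibreBaseChangeIso (Spec.map (CommRingCat.ofHom (algebraMap D (integralClosure D L')))) (((geomClosedPointIsoSpecResidueField v).inv.left ≫ (specRingHomι (closureValuationSubring (v.adicCompletion K))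 (toClosureValuationSubring v) (IsLocalRing.residue (closureValuationSubring (v.adicCompletion K)))).left) ≫ Spec.map (CommRingCat.ofHom h'))).symm).hom ≫ fibreHom U (((geomClosedPointIsoSpecResidueField v).inv.left ≫ (specRingHomι (closureValuationSubring (v.adicCompletion K)) (toClosureValuationSubring v) (IsLocalRing.residue (closureValuationSubring (v.adicCompletion K)))).left) ≫ Spec.map (CommRingCat.ofHom h')) ≫ (𝒞.fibreBaseChangeIso (pullback.fst 𝓨.total.hom (specResidueField v)) (𝓨.geomReductionMap x'').left ≪≫ 𝒞.fibreCongrPtIso hspt'' ≪≫ (𝒞.fibreBaseChangeIso z''.left (((geomClosedPointIsoSpecResidueField v).inv.left ≫ (specRingHomι (closureValuationSubring (v.adicCompletion K)) (toClosureValuationSubring v) (IsLocalRing.residue (closureValuationSubring (v.adicCompletion K)))).left) ≫ Spec.map (CommRingCat.ofHom h))).symm ≪≫ ((𝒞.baseChange z''.left).fibreCongrPtIso et).symm ≪≫ ((𝒞.baseChange z''.left).fibreBaseChangeIso (Spec.map (CommRingCat.ofHom (algebraMap D (integralClosure D L')))) (((geomClosedPointIsoSpecResidueField v).inv.left ≫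 (specRingHomι (closureValuationSubring (v.adicCompletion K)) (toClosureValuationSubring v) (IsLocalRing.residue (closureValuationSubring (v.adicCompletion K)))).left) ≫ Spec.map (CommRingCat.ofHom h'))).symm).inv).hom.hom.hom,
    ((𝒜.fibreBaseChangeIso (pullback.fst 𝓨.total.hom (specResidueField v)) (𝓨.geomReductionMap x).left ≪≫ 𝒜.fibreCongrPtIso hspt ≪≫ (𝒜.fibreBaseChangeIso z.left (((geomClosedPointIsoSpecResidueField v).inv.left ≫ (specRingHomι (closureValuationSubring (v.adicCompletion K)) (toClosureValuationSubring v) (IsLocalRing.residue (closureValuationSubring (v.adicCompletion K)))).left) ≫ Spec.map (CommRingCat.ofHom h))).symm ≪≫ ((𝒜.baseChange z.left).fibreCongrPtIso et).symm ≪≫ ((𝒜.baseChange z.left).fibreBaseChangeIso (Spec.map (CommRingCat.ofHom (algebraMap D (integralClosure D L')))) (((geomClosedPointIsoSpecResidueField v).inv.left ≫ (specRingHomι (closureValuationSubring (v.adicCompletion K)) (toClosureValuationSubring v) (IsLocalRing.residue (closureValuationSubring (v.adicCompletion K)))).left) ≫ Spec.map (CommRingCat.ofHom h'))).symm).hom ≫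 fibreHom U (((geomClosedPointIsoSpecResidueField v).inv.left ≫ (specRingHomι (closureValuationSubring (v.adicCompletion K)) (toClosureValuationSubring v) (IsLocalRing.residue (closureValuationSubring (v.adicCompletion K)))).left) ≫ Spec.map (CommRingCat.ofHom h')) ≫ (𝒞.fibreBaseChangeIso (pullback.fst 𝓨.total.hom (specResidueField v)) (𝓨.geomReductionMap x'').left ≪≫ 𝒞.fibreCongrPtIso hspt'' ≪≫ (𝒞.fibreBaseChangeIso z''.left (((geomClosedPointIsoSpecResidueField v).inv.left ≫ (specRingHomι (closureValuationSubring (v.adicCompletion K)) (toClosureValuationSubring v) (IsLocalRing.residue (closureValuationSubring (v.adicCompletion K)))).left) ≫ Spec.map (CommRingCat.ofHom h))).symm ≪≫ ((𝒞.baseChange z''.left).fibreCongrPtIso et).symm ≪≫ ((𝒞.baseChange z''.left).fibreBaseChangeIso (Spec.map (CommRingCat.ofHom (algebraMap D (integralClosure D L')))) (((geomClosedPointIsoSpecResidueField v).inv.left ≫ (specRingHomι (closureValuationSubring (v.adicCompletion K)) (toClosureValuationSubring v) (IsLocalRing.residue (closureValuationSubring (v.adicCompletion K)))).left) ≫ Spec.map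 (CommRingCat.ofHom h'))).symm).inv).hom.hom.isMonHom_hom, ?_, ?_, ?_, ?_⟩
  · -- (i) finite surjective ⇒ flat surjective: `u` is an isogeny ⇒ (★ (ν7)) `U_{t′}` is ⇒ `ū` is (★ `isIsogeny_hom_comp_iso`) ⇒ flat (★ `IsIsogeny.flat`)
    intro hfin hsurj
    have hu : AbelianVariety.IsIsogeny (homOfIsMonHom u) := ⟨hsurj, hfin⟩
    have hub : AbelianVariety.IsIsogeny ((𝒜.fibreBaseChangeIso (pullback.fst 𝓨.total.hom (specResidueField v)) (𝓨.geomReductionMap x).left ≪≫ 𝒜.fibreCongrPtIso hspt ≪≫ (𝒜.fibreBaseChangeIso z.left (((geomClosedPointIsoSpecResidueField v).inv.left ≫ (specRingHomι (closureValuationSubring (v.adicCompletion K)) (toClosureValuationSubring v) (IsLocalRing.residue (closureValuationSubring (v.adicCompletion K)))).left) ≫ Spec.map (CommRingCat.ofHom h))).symm ≪≫ ((𝒜.baseChange z.left).fibreCongrPtIso et).symm ≪≫ ((𝒜.baseChange z.left).fibreBaseChangeIso (Spec.map (CommRingCat.ofHom (algebraMap D (integralClosure D L')))) (((geomClosedPointIsoSpecResidueField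 v).inv.left ≫ (specRingHomι (closureValuationSubring (v.adicCompletion K)) (toClosureValuationSubring v) (IsLocalRing.residue (closureValuationSubring (v.adicCompletion K)))).left) ≫ Spec.map (CommRingCat.ofHom h'))).symm).hom ≫ fibreHom U (((geomClosedPointIsoSpecResidueField v).inv.left ≫ (specRingHomι (closureValuationSubring (v.adicCompletion K)) (toClosureValuationSubring v) (IsLocalRing.residue (closureValuationSubring (v.adicCompletion K)))).left) ≫ Spec.map (CommRingCat.ofHom h')) ≫ (𝒞.fibreBaseChangeIso (pullback.fst 𝓨.total.hom (specResidueField v)) (𝓨.geomReductionMap x'').left ≪≫ 𝒞.fibreCongrPtIso hspt'' ≪≫ (𝒞.fibreBaseChangeIso z''.left (((geomClosedPointIsoSpecResidueField v).inv.left ≫ (specRingHomι (closureValuationSubring (v.adicCompletion K)) (toClosureValuationSubring v) (IsLocalRing.residue (closureValuationSubring (v.adicCompletion K)))).left) ≫ Spec.map (CommRingCat.ofHom h))).symm ≪≫ ((𝒞.baseChange z''.left).fibreCongrPtIso et).symm ≪≫ ((𝒞.baseChange z''.left).fibreBaseChangeIso (Spec.map (CommRingCat.ofHom (algebraMap D (integralClosure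 D L')))) (((geomClosedPointIsoSpecResidueField v).inv.left ≫ (specRingHomι (closureValuationSubring (v.adicCompletion K)) (toClosureValuationSubring v) (IsLocalRing.residue (closureValuationSubring (v.adicCompletion K)))).left) ≫ Spec.map (CommRingCat.ofHom h'))).symm).inv) :=
      isIsogeny_hom_comp_iso (𝒜.fibreBaseChangeIso (pullback.fst 𝓨.total.hom (specResidueField v)) (𝓨.geomReductionMap x).left ≪≫ 𝒜.fibreCongrPtIso hspt ≪≫ (𝒜.fibreBaseChangeIso z.left (((geomClosedPointIsoSpecResidueField v).inv.left ≫ (specRingHomι (closureValuationSubring (v.adicCompletion K)) (toClosureValuationSubring v) (IsLocalRing.residue (closureValuationSubring (v.adicCompletion K)))).left) ≫ Spec.map (CommRingCat.ofHom h))).symm ≪≫ ((𝒜.baseChange z.left).fibreCongrPtIso et).symm ≪≫ ((𝒜.baseChange z.left).fibreBaseChangeIso (Spec.map (CommRingCat.ofHom (algebraMap D (integralClosure D L')))) (((geomClosedPointIsoSpecResidueField v).inv.left ≫ (specRingHomι (closureValuationSubring (v.adicCompletion K)) (toClosureValuationSubring v) (IsLocalRing.residue (closureValuationSubring (v.adicCompletion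 K)))).left) ≫ Spec.map (CommRingCat.ofHom h'))).symm) (fibreHom U (((geomClosedPointIsoSpecResidueField v).inv.left ≫ (specRingHomι (closureValuationSubring (v.adicCompletion K)) (toClosureValuationSubring v) (IsLocalRing.residue (closureValuationSubring (v.adicCompletion K)))).left) ≫ Spec.map (CommRingCat.ofHom h'))) (𝒞.fibreBaseChangeIso (pullback.fst 𝓨.total.hom (specResidueField v)) (𝓨.geomReductionMap x'').left ≪≫ 𝒞.fibreCongrPtIso hspt'' ≪≫ (𝒞.fibreBaseChangeIso z''.left (((geomClosedPointIsoSpecResidueField v).inv.left ≫ (specRingHomι (closureValuationSubring (v.adicCompletion K)) (toClosureValuationSubring v) (IsLocalRing.residue (closureValuationSubring (v.adicCompletion K)))).left) ≫ Spec.map (CommRingCat.ofHom h))).symm ≪≫ ((𝒞.baseChange z''.left).fibreCongrPtIso et).symm ≪≫ ((𝒞.baseChange z''.left).fibreBaseChangeIso (Spec.map (CommRingCat.ofHom (algebraMap D (integralClosure D L')))) (((geomClosedPointIsoSpecResidueField v).inv.left ≫ (specRingHomι (closureValuationSubring (v.adicCompletion K)) (toClosureValuationSubring v) (IsLocalRing.residue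 (closureValuationSubring (v.adicCompletion K)))).left) ≫ Spec.map (CommRingCat.ofHom h'))).symm).symm (hisog hu (((geomClosedPointIsoSpecResidueField v).inv.left ≫ (specRingHomι (closureValuationSubring (v.adicCompletion K)) (toClosureValuationSubring v) (IsLocalRing.residue (closureValuationSubring (v.adicCompletion K)))).left) ≫ Spec.map (CommRingCat.ofHom h')))
    exact ⟨hub.flat, hub.1.surj⟩
  · -- (ii) equivariance transfers (§1 `baseChangeHom_comp_specialFibre_eq_of_generic` at the turnkey's two stages)
    intro f g hf hg hfg
    exact baseChangeHom_comp_specialFibre_eq_of_generic (𝓨.genericIso'.inv.left ≫ pullback.fst 𝓨.total.hom (specGenericPoint (valuationSubringAtPrime K v) K)) z.left z''.left (Spec.map (CommRingCat.ofHom (algebraMap D (integralClosure D L')))) x.left x''.left (specGenericPoint (closureValuationSubring (v.adicCompletion K)) (AlgebraicClosure (v.adicCompletion K)) ≫ Spec.map (CommRingCat.ofHom h)) (specGenericPoint (closureValuationSubring (v.adicCompletion K)) (AlgebraicClosure (v.adicCompletion K)) ≫ Spec.map (CommRingCat.ofHom h')) hpt hpt'' e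
      (pullback.fst 𝓨.total.hom (specResidueField v)) (𝓨.geomReductionMap x).left (𝓨.geomReductionMap x'').left (((geomClosedPointIsoSpecResidueField v).inv.left ≫ (specRingHomι (closureValuationSubring (v.adicCompletion K)) (toClosureValuationSubring v) (IsLocalRing.residue (closureValuationSubring (v.adicCompletion K)))).left) ≫ Spec.map (CommRingCat.ofHom h)) (((geomClosedPointIsoSpecResidueField v).inv.left ≫ (specRingHomι (closureValuationSubring (v.adicCompletion K)) (toClosureValuationSubring v) (IsLocalRing.residue (closureValuationSubring (v.adicCompletion K)))).left) ≫ Spec.map (CommRingCat.ofHom h')) hspt hspt'' et 𝒜 𝒞 U u hfib f g hfg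
  · -- (iii) section values transfer (§1 `map_specialFibre_restrictPt_eq_of_generic`)
    intro τ τ'' hτ
    exact map_specialFibre_restrictPt_eq_of_generic (𝓨.genericIso'.inv.left ≫ pullback.fst 𝓨.total.hom (specGenericPoint (valuationSubringAtPrime K v) K)) z.left z''.left (Spec.map (CommRingCat.ofHom (algebraMap D (integralClosure D L')))) x.left x''.left (specGenericPoint (closureValuationSubring (v.adicCompletion K)) (AlgebraicClosure (v.adicCompletion K)) ≫ Spec.map (CommRingCat.ofHom h)) (specGenericPoint (closureValuationSubring (v.adicCompletion K)) (AlgebraicClosure (v.adicCompletion K)) ≫ Spec.map (CommRingCat.ofHom h')) hpt hpt'' e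
      (pullback.fst 𝓨.total.hom (specResidueField v)) (𝓨.geomReductionMap x).left (𝓨.geomReductionMap x'').left (((geomClosedPointIsoSpecResidueField v).inv.left ≫ (specRingHomι (closureValuationSubring (v.adicCompletion K)) (toClosureValuationSubring v) (IsLocalRing.residue (closureValuationSubring (v.adicCompletion K)))).left) ≫ Spec.map (CommRingCat.ofHom h)) (((geomClosedPointIsoSpecResidueField v).inv.left ≫ (specRingHomι (closureValuationSubring (v.adicCompletion K)) (toClosureValuationSubring v) (IsLocalRing.residue (closureValuationSubring (v.adicCompletion K)))).left) ≫ Spec.map (CommRingCat.ofHom h')) hspt hspt'' et 𝒜 𝒞 U u hfib τ τ'' hτ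
  · -- (iv) the polarisation law transfers (§1 `specialFibre_comp_lam_comp_dualIsogenyOver_eq_of_generic`; the refined stage `Spec D′` is connected, reduced, Noetherian)
    intro D𝒜 pol𝒜 D𝒞 pol𝒞 n hlam
    haveI : IsNoetherianRing (integralClosure D L') := inferInstance
    exact specialFibre_comp_lam_comp_dualIsogenyOver_eq_of_generic (𝓨.genericIso'.inv.left ≫ pullback.fst 𝓨.total.hom (specGenericPoint (valuationSubringAtPrime K v) K)) z.left z''.left (Spec.map (CommRingCat.ofHom (algebraMap D (integralClosure D L')))) x.left x''.left (specGenericPoint (closureValuationSubring (v.adicCompletion K)) (AlgebraicClosure (v.adicCompletion K)) ≫ Spec.map (CommRingCat.ofHom h)) (specGenericPoint (closureValuationSubring (v.adicCompletion K)) (AlgebraicClosure (v.adicCompletion K)) ≫ Spec.map (CommRingCat.ofHom h')) hpt hpt'' e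
      (pullback.fst 𝓨.total.hom (specResidueField v)) (𝓨.geomReductionMap x).left (𝓨.geomReductionMap x'').left (((geomClosedPointIsoSpecResidueField v).inv.left ≫ (specRingHomι (closureValuationSubring (v.adicCompletion K)) (toClosureValuationSubring v) (IsLocalRing.residue (closureValuationSubring (v.adicCompletion K)))).left) ≫ Spec.map (CommRingCat.ofHom h)) (((geomClosedPointIsoSpecResidueField v).inv.left ≫ (specRingHomι (closureValuationSubring (v.adicCompletion K)) (toClosureValuationSubring v) (IsLocalRing.residue (closureValuationSubring (v.adicCompletion K)))).left) ≫ Spec.map (CommRingCat.ofHom h')) hspt hspt'' et 𝒜 𝒞 U u hfib D𝒜 pol𝒜 D𝒞 pol𝒞 n hlam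

end Head

end AbelianSchemeOver

end Literature.AlgebraicGeometry.AbelianSchemes

end
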